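import Summits.BirchSwinnertonDyer.BirchSwinnertonDyer.Theorems.ByReductionTypeAtTwoSupersingularThetaHabitatTP2ItemsUpper
import Summits.BirchSwinnertonDyer.BirchSwinnertonDyer.Theorems.ByReductionTypeAtTwoSupersingularThetaTP2ByNameClass14157s
import Summits.BirchSwinnertonDyer.BirchSwinnertonDyer.Theorems.ByReductionTypeAtTwoSupersingularThetaTP2ByNameClass35131b
import Summits.BirchSwinnertonDyer.BirchSwinnertonDyer.Theorems.ByReductionTypeAtTwoSupersingularThetaTP2ByNameClass61347g
import Summits.BirchSwinnertonDyer.BirchSwinnertonDyer.Theorems.ByReductionTypeAtTwoSupersingularThetaTP2ByNameClass81075n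
import Summits.BirchSwinnertonDyer.BirchSwinnertonDyer.Theorems.ByReductionTypeAtTwoSupersingularThetaTP2ByNameClass107217l
import Summits.BirchSwinnertonDyer.BirchSwinnertonDyer.Theorems.ByReductionTypeAtTwoSupersingularThetaTP2ByNameClass110693a
import Summits.BirchSwinnertonDyer.BirchSwinnertonDyer.Theorems.ByReductionTypeAtTwoSupersingularThetaTP2ByNameClass132845b
import HarnessLib
-- buildfix (bf3-g30) G30-21: comment-only touch to re-dispatch the lane build (dead-lettered rc 76 (att 6-7, last 03:38/05:35 08-28) although the file and its whole closure are farm-green and the blocking root has a hub olean (lane datum: host-local stale dependency olean); no build event for 10 h); declarations byte-identical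

/-!
# Crux `SupersingularRankZeroAtTwo` (item stmt-BirchSwinnertonDyer-19097, route ByReductionTypeAtTwo, rung K4): THETA-HABITAT road, UPPER-HALF CLASS DISPLAYS,
# group A (14157s, 35131b, 61347g, 81075n, 107217l, 110693a, 132845b) — Miller's upper bound `ord₂ #Ш(E) ≤ ord₂ #Ш_an(E)` (`MissingUpperBoundAt E 2`) from THREE route-TP2 items BY NAME (K2r0 20312 at the
# CM partner, K3 20308 and K4 20309 at `E`) and the torsion-and-`μ` transport in the kernel (21414 CLOSED) — NO `λ`, NO layer certificate, NO item 21415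
# (seat `bsd-2adic-ss-1x` GEN 7, generator `work/ua2/gen_hab_upper.py`; door `…ThetaHabitatTP2ItemsUpper`)

HONEST FRAMING (cells `bsd-2adic` and `bsd-wall`; HUMAN RULINGS D-0036/D-0054/D-0074): CLASS INSTANCES, not bookings; THEOREMS ONLY — no definition, no named
fact, no instance, no `sorry`; the three items are hypotheses; each theorem is a HALF of BSD₂ at the class, not BSD₂; closes nothing; BSD is NOT proved by any of
this. PARTITION (D-0054): X5@2 good-ss `a₂ = 0` THETA-HABITAT sub-row (19/208 r0 classes; here 14157s, 35131b, 61347g, 81075n, 107217l, 110693a, 132845b) × `p = 2` — types-the-object-of; bears_on: K4 19097 ·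
TP2 20312 · 20308 · 20309 · 21414 (closed). Per class `E` (CM partner `A`, Tschirnhaus pair and curve facts from the GEN 0–6 class files): PUB {`hmod`, `hGZK`,
`h2`} + ITEMS {`hK2`, `hK3`, `hK4`} + CERT {`hLA : L(A,1) ≠ 0`} ⟹ `∀ W = M_E ⊗ ℚ, L(W,1) ≠ 0 → MissingUpperBoundAt W 2`, via
`SSThetaRoad.missingUpperBoundAt_two_baseChange_int_of_thetaPartnerItems_at`. Compared with the full displays `bsdp_two_<lab>_of_thetaPartnerItems` (GEN 6,
same classes): the fourth item 21415 and both layer certificates `hMTW`, `hMTA` are NOT needed for the upper half. References: [Kobayashi2003] Thm. 1.2, 4.1;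
[Kato2004Asterisque] Thm. 12.4–12.5 (3); [BDKim2013] Cor. 3.15; [BDKim2009] Cor. 2.13; [PollackRubin2004] Thm. 7.3; [AbbesUllmo1996] Thm. A;
[CremonaAlgorithms1997] Table 1; [Miller2011LMS] Def. 1.1.
-/

set_option autoImplicit false
-- the Theorems namespace of this sub repeats the summit name by design (D-0017 nested layout)
set_option linter.dupNamespace false

noncomputable section

open scoped Classical Polynomial

open CongruenceSubgroup WeierstrassCurve Literature.NumberTheory.EllipticCurves
  Literature.NumberTheory.EllipticCurves.ModularForms
  Literature.NumberTheory.EllipticCurves.Rank1Residual Literature.NumberTheory.EllipticCurves.Rank1Residual.Typed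
  Literature.NumberTheory.EllipticCurves.Kobayashi2003 Literature.NumberTheory.EllipticCurves.IwasawaDual
  Literature.NumberTheory.IwasawaTheory
  ZpExtension Summit.BirchSwinnertonDyer.Rank1Residual Summit.BirchSwinnertonDyer.Rank1Residual.Supersingular
  Summit.BirchSwinnertonDyer.Rank1Residual.X5 Summit.BirchSwinnertonDyer.Rank1Residual.X5.O1
  Summit.BirchSwinnertonDyer.Rank1Residual.X5.Instances Summit.BirchSwinnertonDyer.Rank1Residual.X1.MuLambda
  Summit.BirchSwinnertonDyer.BirchSwinnertonDyer.Theses.ThetaPartnerAtTwo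
  Summit.BirchSwinnertonDyer.BirchSwinnertonDyer

namespace Summit.BirchSwinnertonDyer.BirchSwinnertonDyer.Theorems
namespace SSThetaRoad

/-- **`MissingUpperBoundAt(14157s1, 2)` — the Kato/Miller UPPER HALF on the theta habitat from K2r0/K3/K4 BY NAME** (`E = 14157s1`; CM partner
`A = cmA1089a`): PUB {`hmod`, `hGZK`, `h2`} + route TP2's OPEN items `hK2 : SignedMainConjectureCMTwoRankZero` (20312, at `A`),
`hK3 : SignedKatoDivisibilityUpToAtTwo` (20308), `hK4 : SignedControlAtTwo` (20309) BY NAME + CERT {`hLA : L(A,1) ≠ 0`} + KERNEL {torsion-and-`μ`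
transport along `E[2] ≅ A[2]` (21414 CLOSED; Tschirnhaus `tschirnhaus_root_14157s1`), `E` non-CM, `A` CM}. A half of BSD₂; the three items are hypotheses;
BSD is not proved by this. [cite: Kobayashi2003, Thm. 1.2 and Thm. 4.1] [cite: Kato2004Asterisque, Thm. 12.4–12.5 (3)] [cite: BDKim2013, Cor. 3.15]
[cite: PollackRubin2004, Thm. 7.3] [cite: AbbesUllmo1996, Thm. A] [cite: CremonaAlgorithms1997, Table 1] [cite: Miller2011LMS, Def. 1.1] -/
theorem missingUpperBoundAt_two_14157s1_of_thetaPartnerItems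
    (hmod : nonempty_modularParametrizationData) (hGZK : rank_eq_analyticRank_of_analyticRank_le_one)
    (h2 : realPeriodRat_eq_unit_mul_plusPeriod_two)
    (hK2 : Summit.BirchSwinnertonDyer.BirchSwinnertonDyer.Theses.ThetaPartnerAtTwo.SignedMainConjectureCMTwoRankZero)
    (hK3 : Summit.BirchSwinnertonDyer.BirchSwinnertonDyer.Theses.ThetaPartnerAtTwo.SignedKatoDivisibilityUpToAtTwo)
    (hK4 : Summit.BirchSwinnertonDyer.BirchSwinnertonDyer.Theses.ThetaPartnerAtTwo.SignedControlAtTwo)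
    (hLA : ((⟨0, 0, 1, 0, 30⟩ : WeierstrassCurve ℤ).baseChange ℚ).entireLFunction 1 ≠ 0) :
    ∀ (W : WeierstrassCurve ℚ) [W.IsElliptic] [W.IsGloballyMinimal],
      W = ((⟨0, 0, 1, -429215556, -3422640592418⟩ : WeierstrassCurve ℤ).baseChange ℚ) → W.entireLFunction 1 ≠ 0 → MissingUpperBoundAt W 2 := by
  intro W _ _ hW hL
  subst hW
  haveI := SSThetaRoad.isElliptic_cmA1089a
  haveI := SSThetaRoad.isGloballyMinimal_cmA1089a
  exact missingUpperBoundAt_two_baseChange_int_of_thetaPartnerItems_at _ _ hmod hGZK h2 hK2 hK3 hK4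
    SSColemanRoad.not_hasCM_14157s1 hL SSColemanRoad.goodSS_two_14157s1.2.2 SSColemanRoad.goodSS_two_14157s1.2.1
    SSThetaRoad.hasCM_cmA1089a hLA SSThetaRoad.goodSS_two_cmA1089a.2.2 SSThetaRoad.goodSS_two_cmA1089a.2.1 _ _
    tschirnhaus_root_14157s1 tschirnhaus_inv_14157s1

/-- **`MissingUpperBoundAt(35131b1, 2)` — the Kato/Miller UPPER HALF on the theta habitat from K2r0/K3/K4 BY NAME** (`E = 35131b1`; CM partner
`A = cmA16641e`): PUB {`hmod`, `hGZK`, `h2`} + route TP2's OPEN items `hK2 : SignedMainConjectureCMTwoRankZero` (20312, at `A`),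
`hK3 : SignedKatoDivisibilityUpToAtTwo` (20308), `hK4 : SignedControlAtTwo` (20309) BY NAME + CERT {`hLA : L(A,1) ≠ 0`} + KERNEL {torsion-and-`μ`
transport along `E[2] ≅ A[2]` (21414 CLOSED; Tschirnhaus `tschirnhaus_root_35131b1`), `E` non-CM, `A` CM}. A half of BSD₂; the three items are hypotheses;
BSD is not proved by this. [cite: Kobayashi2003, Thm. 1.2 and Thm. 4.1] [cite: Kato2004Asterisque, Thm. 12.4–12.5 (3)] [cite: BDKim2013, Cor. 3.15]
[cite: PollackRubin2004, Thm. 7.3] [cite: AbbesUllmo1996, Thm. A] [cite: CremonaAlgorithms1997, Table 1] [cite: Miller2011LMS, Def. 1.1] -/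
theorem missingUpperBoundAt_two_35131b1_of_thetaPartnerItems
    (hmod : nonempty_modularParametrizationData) (hGZK : rank_eq_analyticRank_of_analyticRank_le_one)
    (h2 : realPeriodRat_eq_unit_mul_plusPeriod_two)
    (hK2 : Summit.BirchSwinnertonDyer.BirchSwinnertonDyer.Theses.ThetaPartnerAtTwo.SignedMainConjectureCMTwoRankZero)
    (hK3 : Summit.BirchSwinnertonDyer.BirchSwinnertonDyer.Theses.ThetaPartnerAtTwo.SignedKatoDivisibilityUpToAtTwo)
    (hK4 : Summit.BirchSwinnertonDyer.BirchSwinnertonDyer.Theses.ThetaPartnerAtTwo.SignedControlAtTwo)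
    (hLA : ((⟨0, 0, 1, -7740, -262096⟩ : WeierstrassCurve ℤ).baseChange ℚ).entireLFunction 1 ≠ 0) :
    ∀ (W : WeierstrassCurve ℚ) [W.IsElliptic] [W.IsGloballyMinimal],
      W = ((⟨0, -1, 1, -30784617, -65738528417⟩ : WeierstrassCurve ℤ).baseChange ℚ) → W.entireLFunction 1 ≠ 0 → MissingUpperBoundAt W 2 := by
  intro W _ _ hW hL
  subst hW
  haveI := SSThetaRoad.isElliptic_cmA16641e
  haveI := SSThetaRoad.isGloballyMinimal_cmA16641e
  exact missingUpperBoundAt_two_baseChange_int_of_thetaPartnerItems_at _ _ hmod hGZK h2 hK2 hK3 hK4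
    SSColemanRoad.not_hasCM_35131b1 hL SSColemanRoad.goodSS_two_35131b1.2.2 SSColemanRoad.goodSS_two_35131b1.2.1
    SSThetaRoad.hasCM_cmA16641e hLA SSThetaRoad.goodSS_two_cmA16641e.2.2 SSThetaRoad.goodSS_two_cmA16641e.2.1 _ _
    tschirnhaus_root_35131b1 tschirnhaus_inv_35131b1

/-- **`MissingUpperBoundAt(61347g1, 2)` — the Kato/Miller UPPER HALF on the theta habitat from K2r0/K3/K4 BY NAME** (`E = 61347g1`; CM partner
`A = cmA1089a`): PUB {`hmod`, `hGZK`, `h2`} + route TP2's OPEN items `hK2 : SignedMainConjectureCMTwoRankZero` (20312, at `A`),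
`hK3 : SignedKatoDivisibilityUpToAtTwo` (20308), `hK4 : SignedControlAtTwo` (20309) BY NAME + CERT {`hLA : L(A,1) ≠ 0`} + KERNEL {torsion-and-`μ`
transport along `E[2] ≅ A[2]` (21414 CLOSED; Tschirnhaus `tschirnhaus_root_61347g1`), `E` non-CM, `A` CM}. A half of BSD₂; the three items are hypotheses;
BSD is not proved by this. [cite: Kobayashi2003, Thm. 1.2 and Thm. 4.1] [cite: Kato2004Asterisque, Thm. 12.4–12.5 (3)] [cite: BDKim2013, Cor. 3.15]
[cite: PollackRubin2004, Thm. 7.3] [cite: AbbesUllmo1996, Thm. A] [cite: CremonaAlgorithms1997, Table 1] [cite: Miller2011LMS, Def. 1.1] -/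
theorem missingUpperBoundAt_two_61347g1_of_thetaPartnerItems
    (hmod : nonempty_modularParametrizationData) (hGZK : rank_eq_analyticRank_of_analyticRank_le_one)
    (h2 : realPeriodRat_eq_unit_mul_plusPeriod_two)
    (hK2 : Summit.BirchSwinnertonDyer.BirchSwinnertonDyer.Theses.ThetaPartnerAtTwo.SignedMainConjectureCMTwoRankZero)
    (hK3 : Summit.BirchSwinnertonDyer.BirchSwinnertonDyer.Theses.ThetaPartnerAtTwo.SignedKatoDivisibilityUpToAtTwo)
    (hK4 : Summit.BirchSwinnertonDyer.BirchSwinnertonDyer.Theses.ThetaPartnerAtTwo.SignedControlAtTwo)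
    (hLA : ((⟨0, 0, 1, 0, 30⟩ : WeierstrassCurve ℤ).baseChange ℚ).entireLFunction 1 ≠ 0) :
    ∀ (W : WeierstrassCurve ℚ) [W.IsElliptic] [W.IsGloballyMinimal],
      W = ((⟨0, -1, 1, -66609209, -209220120484⟩ : WeierstrassCurve ℤ).baseChange ℚ) → W.entireLFunction 1 ≠ 0 → MissingUpperBoundAt W 2 := by
  intro W _ _ hW hL
  subst hW
  haveI := SSThetaRoad.isElliptic_cmA1089a
  haveI := SSThetaRoad.isGloballyMinimal_cmA1089a
  exact missingUpperBoundAt_two_baseChange_int_of_thetaPartnerItems_at _ _ hmod hGZK h2 hK2 hK3 hK4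
    SSColemanRoad.not_hasCM_61347g1 hL SSColemanRoad.goodSS_two_61347g1.2.2 SSColemanRoad.goodSS_two_61347g1.2.1
    SSThetaRoad.hasCM_cmA1089a hLA SSThetaRoad.goodSS_two_cmA1089a.2.2 SSThetaRoad.goodSS_two_cmA1089a.2.1 _ _
    tschirnhaus_root_61347g1 tschirnhaus_inv_61347g1

/-- **`MissingUpperBoundAt(81075n1, 2)` — the Kato/Miller UPPER HALF on the theta habitat from K2r0/K3/K4 BY NAME** (`E = 81075n1`; CM partner
`A = cmA11025d`): PUB {`hmod`, `hGZK`, `h2`} + route TP2's OPEN items `hK2 : SignedMainConjectureCMTwoRankZero` (20312, at `A`),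
`hK3 : SignedKatoDivisibilityUpToAtTwo` (20308), `hK4 : SignedControlAtTwo` (20309) BY NAME + CERT {`hLA : L(A,1) ≠ 0`} + KERNEL {torsion-and-`μ`
transport along `E[2] ≅ A[2]` (21414 CLOSED; Tschirnhaus `tschirnhaus_root_81075n1`), `E` non-CM, `A` CM}. A half of BSD₂; the three items are hypotheses;
BSD is not proved by this. [cite: Kobayashi2003, Thm. 1.2 and Thm. 4.1] [cite: Kato2004Asterisque, Thm. 12.4–12.5 (3)] [cite: BDKim2013, Cor. 3.15]
[cite: PollackRubin2004, Thm. 7.3] [cite: AbbesUllmo1996, Thm. A] [cite: CremonaAlgorithms1997, Table 1] [cite: Miller2011LMS, Def. 1.1] -/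
theorem missingUpperBoundAt_two_81075n1_of_thetaPartnerItems
    (hmod : nonempty_modularParametrizationData) (hGZK : rank_eq_analyticRank_of_analyticRank_le_one)
    (h2 : realPeriodRat_eq_unit_mul_plusPeriod_two)
    (hK2 : Summit.BirchSwinnertonDyer.BirchSwinnertonDyer.Theses.ThetaPartnerAtTwo.SignedMainConjectureCMTwoRankZero)
    (hK3 : Summit.BirchSwinnertonDyer.BirchSwinnertonDyer.Theses.ThetaPartnerAtTwo.SignedKatoDivisibilityUpToAtTwo)
    (hK4 : Summit.BirchSwinnertonDyer.BirchSwinnertonDyer.Theses.ThetaPartnerAtTwo.SignedControlAtTwo)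
    (hLA : ((⟨0, 0, 1, 0, -429⟩ : WeierstrassCurve ℤ).baseChange ℚ).entireLFunction 1 ≠ 0) :
    ∀ (W : WeierstrassCurve ℚ) [W.IsElliptic] [W.IsGloballyMinimal],
      W = ((⟨0, 1, 1, -61652083, -186344958131⟩ : WeierstrassCurve ℤ).baseChange ℚ) → W.entireLFunction 1 ≠ 0 → MissingUpperBoundAt W 2 := by
  intro W _ _ hW hL
  subst hW
  haveI := SSThetaRoad.isElliptic_cmA11025d
  haveI := SSThetaRoad.isGloballyMinimal_cmA11025d
  exact missingUpperBoundAt_two_baseChange_int_of_thetaPartnerItems_at _ _ hmod hGZK h2 hK2 hK3 hK4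
    SSColemanRoad.not_hasCM_81075n1 hL SSColemanRoad.goodSS_two_81075n1.2.2 SSColemanRoad.goodSS_two_81075n1.2.1
    SSThetaRoad.hasCM_cmA11025d hLA SSThetaRoad.goodSS_two_cmA11025d.2.2 SSThetaRoad.goodSS_two_cmA11025d.2.1 _ _
    tschirnhaus_root_81075n1 tschirnhaus_inv_81075n1

/-- **`MissingUpperBoundAt(107217l1, 2)` — the Kato/Miller UPPER HALF on the theta habitat from K2r0/K3/K4 BY NAME** (`E = 107217l1`; CM partner
`A = cmA477603bg`): PUB {`hmod`, `hGZK`, `h2`} + route TP2's OPEN items `hK2 : SignedMainConjectureCMTwoRankZero` (20312, at `A`),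
`hK3 : SignedKatoDivisibilityUpToAtTwo` (20308), `hK4 : SignedControlAtTwo` (20309) BY NAME + CERT {`hLA : L(A,1) ≠ 0`} + KERNEL {torsion-and-`μ`
transport along `E[2] ≅ A[2]` (21414 CLOSED; Tschirnhaus `tschirnhaus_root_107217l1`), `E` non-CM, `A` CM}. A half of BSD₂; the three items are hypotheses;
BSD is not proved by this. [cite: Kobayashi2003, Thm. 1.2 and Thm. 4.1] [cite: Kato2004Asterisque, Thm. 12.4–12.5 (3)] [cite: BDKim2013, Cor. 3.15]
[cite: PollackRubin2004, Thm. 7.3] [cite: AbbesUllmo1996, Thm. A] [cite: CremonaAlgorithms1997, Table 1] [cite: Miller2011LMS, Def. 1.1] -/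
theorem missingUpperBoundAt_two_107217l1_of_thetaPartnerItems
    (hmod : nonempty_modularParametrizationData) (hGZK : rank_eq_analyticRank_of_analyticRank_le_one)
    (h2 : realPeriodRat_eq_unit_mul_plusPeriod_two)
    (hK2 : Summit.BirchSwinnertonDyer.BirchSwinnertonDyer.Theses.ThetaPartnerAtTwo.SignedMainConjectureCMTwoRankZero)
    (hK3 : Summit.BirchSwinnertonDyer.BirchSwinnertonDyer.Theses.ThetaPartnerAtTwo.SignedKatoDivisibilityUpToAtTwo)
    (hK4 : Summit.BirchSwinnertonDyer.BirchSwinnertonDyer.Theses.ThetaPartnerAtTwo.SignedControlAtTwo)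
    (hLA : ((⟨0, 0, 1, 0, -30956⟩ : WeierstrassCurve ℤ).baseChange ℚ).entireLFunction 1 ≠ 0) :
    ∀ (W : WeierstrassCurve ℚ) [W.IsElliptic] [W.IsGloballyMinimal],
      W = ((⟨0, 0, 1, 2592702, -38604175324⟩ : WeierstrassCurve ℤ).baseChange ℚ) → W.entireLFunction 1 ≠ 0 → MissingUpperBoundAt W 2 := by
  intro W _ _ hW hL
  subst hW
  haveI := SSThetaRoad.isElliptic_cmA477603bg
  haveI := SSThetaRoad.isGloballyMinimal_cmA477603bg
  exact missingUpperBoundAt_two_baseChange_int_of_thetaPartnerItems_at _ _ hmod hGZK h2 hK2 hK3 hK4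
    SSColemanRoad.not_hasCM_107217l1 hL SSColemanRoad.goodSS_two_107217l1.2.2 SSColemanRoad.goodSS_two_107217l1.2.1
    SSThetaRoad.hasCM_cmA477603bg hLA SSThetaRoad.goodSS_two_cmA477603bg.2.2 SSThetaRoad.goodSS_two_cmA477603bg.2.1 _ _
    tschirnhaus_root_107217l1 tschirnhaus_inv_107217l1

/-- **`MissingUpperBoundAt(110693a1, 2)` — the Kato/Miller UPPER HALF on the theta habitat from K2r0/K3/K4 BY NAME** (`E = 110693a1`; CM partner
`A = cmA1089e`): PUB {`hmod`, `hGZK`, `h2`} + route TP2's OPEN items `hK2 : SignedMainConjectureCMTwoRankZero` (20312, at `A`),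
`hK3 : SignedKatoDivisibilityUpToAtTwo` (20308), `hK4 : SignedControlAtTwo` (20309) BY NAME + CERT {`hLA : L(A,1) ≠ 0`} + KERNEL {torsion-and-`μ`
transport along `E[2] ≅ A[2]` (21414 CLOSED; Tschirnhaus `tschirnhaus_root_110693a1`), `E` non-CM, `A` CM}. A half of BSD₂; the three items are hypotheses;
BSD is not proved by this. [cite: Kobayashi2003, Thm. 1.2 and Thm. 4.1] [cite: Kato2004Asterisque, Thm. 12.4–12.5 (3)] [cite: BDKim2013, Cor. 3.15]
[cite: PollackRubin2004, Thm. 7.3] [cite: AbbesUllmo1996, Thm. A] [cite: CremonaAlgorithms1997, Table 1] [cite: Miller2011LMS, Def. 1.1] -/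
theorem missingUpperBoundAt_two_110693a1_of_thetaPartnerItems
    (hmod : nonempty_modularParametrizationData) (hGZK : rank_eq_analyticRank_of_analyticRank_le_one)
    (h2 : realPeriodRat_eq_unit_mul_plusPeriod_two)
    (hK2 : Summit.BirchSwinnertonDyer.BirchSwinnertonDyer.Theses.ThetaPartnerAtTwo.SignedMainConjectureCMTwoRankZero)
    (hK3 : Summit.BirchSwinnertonDyer.BirchSwinnertonDyer.Theses.ThetaPartnerAtTwo.SignedKatoDivisibilityUpToAtTwo)
    (hK4 : Summit.BirchSwinnertonDyer.BirchSwinnertonDyer.Theses.ThetaPartnerAtTwo.SignedControlAtTwo)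
    (hLA : ((⟨0, 0, 1, -66, -212⟩ : WeierstrassCurve ℤ).baseChange ℚ).entireLFunction 1 ≠ 0) :
    ∀ (W : WeierstrassCurve ℚ) [W.IsElliptic] [W.IsGloballyMinimal],
      W = ((⟨0, 1, 1, -1085259, -476541755⟩ : WeierstrassCurve ℤ).baseChange ℚ) → W.entireLFunction 1 ≠ 0 → MissingUpperBoundAt W 2 := by
  intro W _ _ hW hL
  subst hW
  haveI := SSThetaRoad.isElliptic_cmA1089e
  haveI := SSThetaRoad.isGloballyMinimal_cmA1089e
  exact missingUpperBoundAt_two_baseChange_int_of_thetaPartnerItems_at _ _ hmod hGZK h2 hK2 hK3 hK4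
    SSColemanRoad.not_hasCM_110693a1 hL SSColemanRoad.goodSS_two_110693a1.2.2 SSColemanRoad.goodSS_two_110693a1.2.1
    SSThetaRoad.hasCM_cmA1089e hLA SSThetaRoad.goodSS_two_cmA1089e.2.2 SSThetaRoad.goodSS_two_cmA1089e.2.1 _ _
    tschirnhaus_root_110693a1 tschirnhaus_inv_110693a1

/-- **`MissingUpperBoundAt(132845b1, 2)` — the Kato/Miller UPPER HALF on the theta habitat from K2r0/K3/K4 BY NAME** (`E = 132845b1`; CM partner
`A = cmA239121b`): PUB {`hmod`, `hGZK`, `h2`} + route TP2's OPEN items `hK2 : SignedMainConjectureCMTwoRankZero` (20312, at `A`),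
`hK3 : SignedKatoDivisibilityUpToAtTwo` (20308), `hK4 : SignedControlAtTwo` (20309) BY NAME + CERT {`hLA : L(A,1) ≠ 0`} + KERNEL {torsion-and-`μ`
transport along `E[2] ≅ A[2]` (21414 CLOSED; Tschirnhaus `tschirnhaus_root_132845b1`), `E` non-CM, `A` CM}. A half of BSD₂; the three items are hypotheses;
BSD is not proved by this. [cite: Kobayashi2003, Thm. 1.2 and Thm. 4.1] [cite: Kato2004Asterisque, Thm. 12.4–12.5 (3)] [cite: BDKim2013, Cor. 3.15]
[cite: PollackRubin2004, Thm. 7.3] [cite: AbbesUllmo1996, Thm. A] [cite: CremonaAlgorithms1997, Table 1] [cite: Miller2011LMS, Def. 1.1] -/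
theorem missingUpperBoundAt_two_132845b1_of_thetaPartnerItems
    (hmod : nonempty_modularParametrizationData) (hGZK : rank_eq_analyticRank_of_analyticRank_le_one)
    (h2 : realPeriodRat_eq_unit_mul_plusPeriod_two)
    (hK2 : Summit.BirchSwinnertonDyer.BirchSwinnertonDyer.Theses.ThetaPartnerAtTwo.SignedMainConjectureCMTwoRankZero)
    (hK3 : Summit.BirchSwinnertonDyer.BirchSwinnertonDyer.Theses.ThetaPartnerAtTwo.SignedKatoDivisibilityUpToAtTwo)
    (hK4 : Summit.BirchSwinnertonDyer.BirchSwinnertonDyer.Theses.ThetaPartnerAtTwo.SignedControlAtTwo)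
    (hLA : ((⟨0, 0, 1, -19569780, -33321690691⟩ : WeierstrassCurve ℤ).baseChange ℚ).entireLFunction 1 ≠ 0) :
    ∀ (W : WeierstrassCurve ℚ) [W.IsElliptic] [W.IsGloballyMinimal],
      W = ((⟨0, -1, 1, 2887165, 1064441473⟩ : WeierstrassCurve ℤ).baseChange ℚ) → W.entireLFunction 1 ≠ 0 → MissingUpperBoundAt W 2 := by
  intro W _ _ hW hL
  subst hW
  haveI := SSThetaRoad.isElliptic_cmA239121b
  haveI := SSThetaRoad.isGloballyMinimal_cmA239121b
  exact missingUpperBoundAt_two_baseChange_int_of_thetaPartnerItems_at _ _ hmod hGZK h2 hK2 hK3 hK4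
    SSColemanRoad.not_hasCM_132845b1 hL SSColemanRoad.goodSS_two_132845b1.2.2 SSColemanRoad.goodSS_two_132845b1.2.1
    SSThetaRoad.hasCM_cmA239121b hLA SSThetaRoad.goodSS_two_cmA239121b.2.2 SSThetaRoad.goodSS_two_cmA239121b.2.1 _ _
    tschirnhaus_root_132845b1 tschirnhaus_inv_132845b1

end SSThetaRoad
end Summit.BirchSwinnertonDyer.BirchSwinnertonDyer.Theorems

end
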